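import Mathlib
import Literature.NumberTheory.LFunctions.Zhang2022.Section10Theta1Evals
import Literature.NumberTheory.LFunctions.Zhang2022.TypedSection10C
import HarnessLib

/-!
# Zhang (2022) §10c: the deduction nodes `Ded1014`, `Ded1016` DISCHARGED

Topic `Literature/NumberTheory/LFunctions/Zhang2022` (Landau–Siegel audit tree; verdict-neutral).
Y. Zhang, *Discrete mean estimates and the Landau–Siegel zero*, arXiv:2211.02515v1 (2022)
[Zhang2022LandauSiegel] — **an unrefereed manuscript under adjudication; nothing in this file
asserts any claim of the manuscript.** Cell siegel-zhang (D-0069), DISCHARGE row D02 (cone C26),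
DAG nodes `Z22:(10.14)`, `Z22:(10.16)` [Z22 p.60, (10.14), tex L3063; p.61, (10.16), tex L3130].

`TypedSection10C` (L3-t8) types the manuscript's deductions of (10.14) and (10.16) as the CLAIM
nodes `Ded1014 c′ : SjExpand1422 → Split1422 → (five range claims) → Gather1422 → Prop71 → Eq1014`
and `Ded1016 c′ : SjExpand1214 → Split1214 → (seven range claims) → Gather1214 → Prop71 → Eq1016`.
Their LAST step — "Gathering the above results together we conclude `α⁻¹S_j(·,·) = (…)𝔞 + o(1)`.
Hence, by Proposition 7.1, (10.14) [(10.16)]" — is the generic «by Proposition 7.1» inference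
`Skeleton.theta1_eval_of_prop71` / `eq1014_of_sj` / `eq1016_of_sj` (`Section10Theta1Evals`, sz-d41 + sz-d43,
where the error term `E(𝐚₁,𝐚₂) = 𝔓𝓛²Σ|S_j| = o(𝔓)` of Proposition 7.1 is disposed of in the kernel). Hence both
deduction nodes HOLD (kernel-checked), indeed from `Gather…` and `Prop71` alone:

* `eq1014_of_gather : Prop71 c′ → Gather1422 c′ → Eq1014 c′`, `ded1014_holds : Ded1014 c′`;
* `eq1016_of_gather : Prop71 c′ → Gather1214 c′ → Eq1016 c′`, `ded1016_holds : Ded1016 c′`.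

Theorem-only; 0 new definitions, 0 new facts. WHAT THIS IS NOT: a proof of (10.14)/(10.16)
themselves (their antecedents `Gather1422/1214`, `Prop71` remain CLAIMS), nor of anything about
Theorems 1–2 / Landau–Siegel zeros.

## References

* Y. Zhang, arXiv:2211.02515v1 (2022), §10 pp. 59–61, (10.14), (10.16); §7 Prop. 7.1.
  [cite: Zhang2022LandauSiegel, §10 (10.14), (10.16)]
-/

noncomputable section

open Complex Real ComplexConjugate
open Literature.NumberTheory.LFunctions.Zhang2022.Skeleton

namespace Literature.NumberTheory.LFunctions.Zhang2022.Typed.Sec10C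

variable {c' : ℝ}

/-- The `j`-th instance of the gathered claim `Gather1422` ("`α⁻¹S_j(𝐚₁₄,𝐚₂₂) = (d′₅ⱼ + d₅ⱼ)𝔞 + o(1)`",
Z22:§10.u051) with the selected constant written out. [cite: Zhang2022LandauSiegel, §10 p. 60] -/
theorem gather1422_at (h : Gather1422 c') (j : ℕ) (hj : j ∈ ({1, 2, 3} : Finset ℕ)) {δ : ℂ}
    (hδ : d5pJ j + d5J j = δ) :
    ∀ ε : ℝ, 0 < ε → ForAllLarge fun D _ χ => AssumptionA D χ →
      ‖(alpha D : ℂ)⁻¹ * Sj c' D j (a14 χ) (a22 χ) - δ * frakA χ‖ ≤ ε := by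
  intro ε hε
  refine (h ε hε).mono fun D _ χ _ _ hh hA => ?_
  have key := hh hA j hj
  rwa [hδ] at key

/-- The `j`-th instance of the gathered claim `Gather1214` ("`α⁻¹S_j(𝐚₁₂,𝐚₁₄) = (d′₆ⱼ + d₆ⱼ)𝔞 + o(1)`",
Z22:§10.u058) with the selected constant written out. [cite: Zhang2022LandauSiegel, §10 p. 61] -/
theorem gather1214_at (h : Gather1214 c') (j : ℕ) (hj : j ∈ ({1, 2, 3} : Finset ℕ)) {δ : ℂ}
    (hδ : d6pJ j + d6J j = δ) :
    ∀ ε : ℝ, 0 < ε → ForAllLarge fun D _ χ => AssumptionA D χ →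
      ‖(alpha D : ℂ)⁻¹ * Sj c' D j (a12 χ) (a14 χ) - δ * frakA χ‖ ≤ ε := by
  intro ε hε
  refine (h ε hε).mono fun D _ χ _ _ hh hA => ?_
  have key := hh hA j hj
  rwa [hδ] at key

/-- **Z22:(10.14), "Hence, by Proposition 7.1"** [Z22 p.60, (10.14), tex L3063]: the node `Eq1014 c′`
FOLLOWS (kernel-checked) from `Skeleton.Prop71 c′` and the gathered claim `Gather1422 c′`
(`Skeleton.eq1014_of_sj`, constants `d′₅ⱼ + d₅ⱼ`).
[cite: Zhang2022LandauSiegel, §10 (10.14) p. 60] -/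
theorem eq1014_of_gather (h71 : Prop71 c') (h : Gather1422 c') : Eq1014 c' :=
  eq1014_of_sj h71
    (gather1422_at h 1 (by simp) (by simp [d5pJ, d5J, byJ]))
    (gather1422_at h 2 (by simp) (by simp [d5pJ, d5J, byJ]))
    (gather1422_at h 3 (by simp) (by simp [d5pJ, d5J, byJ]))

/-- **The deduction node `Ded1014` HOLDS** (Z22:(10.14) as a DED step, p.60): of its nine antecedents
only `Gather1422` and `Prop71` are used — the expansion, the split and the five range claims feed
`Gather1422`, which is itself an antecedent. [cite: Zhang2022LandauSiegel, §10 (10.14) p. 60] -/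
theorem ded1014_holds (c' : ℝ) : Ded1014 c' :=
  fun _ _ _ _ _ _ _ hG h71 => eq1014_of_gather h71 hG

/-- **Z22:(10.16), "Hence, by Proposition 7.1"** [Z22 p.61, (10.16), tex L3130]: the node `Eq1016 c′`
(consistent reading `3/2(d′₆₃ + d₆₃)`) FOLLOWS (kernel-checked) from `Skeleton.Prop71 c′` and the
gathered claim `Gather1214 c′` (`Skeleton.eq1016_of_sj`, constants `d′₆ⱼ + d₆ⱼ`).
[cite: Zhang2022LandauSiegel, §10 (10.16) p. 61] -/
theorem eq1016_of_gather (h71 : Prop71 c') (h : Gather1214 c') : Eq1016 c' :=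
  eq1016_of_sj h71
    (gather1214_at h 1 (by simp) (by simp [d6pJ, d6J, byJ]))
    (gather1214_at h 2 (by simp) (by simp [d6pJ, d6J, byJ]))
    (gather1214_at h 3 (by simp) (by simp [d6pJ, d6J, byJ]))

/-- **The deduction node `Ded1016` HOLDS** (Z22:(10.16) as a DED step, p.61): of its eleven
antecedents only `Gather1214` and `Prop71` are used. [cite: Zhang2022LandauSiegel, §10 (10.16) p. 61] -/
theorem ded1016_holds (c' : ℝ) : Ded1016 c' :=
  fun _ _ _ _ _ _ _ _ _ hG h71 => eq1016_of_gather h71 hG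

end Literature.NumberTheory.LFunctions.Zhang2022.Typed.Sec10C
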